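import Mathlib.Analysis.Complex.Hadamard
import Mathlib.Analysis.Complex.AbsMax
import Mathlib.Analysis.SpecialFunctions.Pow.Real
import Summits.QuantumFields.YangMills.Theorems.IR.PurityChannelClassical
import HarnessLib

/-!
# Crux `BalabanLadder.IR` (stmt-QuantumFields-19354) — CLASSICAL POOL TARGETS of the purity-channel family
(ideator ym-ir-idea-16 g0; «optionally isolate P for the pool», crit-4 VERDICT jensen-purity-channel 03:49:58Z)

Pure complex analysis, NO lattice objects.  The two classical stubs of LINES `harmonic-purity-channel` (T = `TwoConstants`)
and `jensen-purity-channel` (P = `PoissonJensen`) restated VERBATIM (same Props, this namespace) so that a pool prover can land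
them `--supports stmt-QuantumFields-19354 --as helper` without touching any lattice file; the same proofs then discharge the
lines' stubs by copy.  NEW here (proved in the docstrings' sense, typed as one M− stub): **P follows from T** by Blaschke factors
of the disc `B(zT, R)` and the maximum modulus principle — no harmonic measure / Perron method is needed:
with `Φ := (F / g) · ∏_{ζ∈s} R / (R² − conj(ζ − zT)(· − zT))` (holomorphic on a neighbourhood of `closure D`, since
`|conj(ζ−zT)(z−zT)| < R²` there), one has `‖Φ‖ = ‖F/G‖ · ∏ ‖b_ζ‖` with the Blaschke factors
`b_ζ(z) = R(z−ζ)/(R² − conj(ζ−zT)(z−zT))`, `‖b_ζ‖ ≤ 1` on `closedBall zT R ⊇ closure D` (lemma `norm_blaschke_le_one`),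
so `‖Φ‖ ≤ A` on `frontier D` hence on `closure D` (Mathlib `Complex.norm_le_of_forall_mem_frontier_norm_le`, `D` bounded),
`‖Φ‖ ≤ a` on the anchor sphere hence on the closed anchor disc (same lemma on the ball); T gives `‖Φ(zT)‖ ≤ a^ω A^{1−ω}`; and
`b_ζ(zT) = (zT − ζ)/R` (lemma `blaschke_target`) turns this into P's conclusion with the SHARP budget `Σ log(R/‖ζ − zT‖)`.
T itself: chain of Hadamard three-circles along a compact path from `z₀` to `zT` inside `D` (three-circles = Mathlib
`Complex.HadamardThreeLines.norm_le_interp_of_mem_verticalClosedStrip₀₁'` after `z = c + e^{u}`; in-tree patterns: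
`Literature…Balaban1983to89.Beta.MomentSymbol.norm_le_interp_of_real_of_strip`, `…EriceRemainderEnclosureHolomorphyRate.norm_le_interp_of_segment`).

POOL UPDATE (prover ym-ir-line-pool-p3 g10, 2026-08-28): BOTH targets are now TREE THEOREMS — `Theorems/IR/PurityChannelClassical.lean`
(p635605, def-free, `--supports stmt-QuantumFields-19354 --as helper`): `PurityChannelClassical.twoConstants_holds` (T; a corollary of the tree's
disc-chain two-constants theorem `ComplexCouplingChannel.exists_exponent_norm_le_rpow_mul_rpow`), `poissonJensen_of_twoConstants` (P ⇐ T, the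
Blaschke argument below) and `poissonJensen_holds` (P).  §4 below now closes by `exact` (this file is sorry-free); the line stubs
`HarmonicPurityChannel.stub_twoConstants` ∕ `JensenPurityChannel.stub_poissonJensen` close the same way on importing that module.

HONEST FRAMING.  Nothing here bears on the Yang–Mills mass gap by itself: these are the classical (M) legs of two ideator lines whose
LOADS (`PurityChannel`, `SparseChannel`) are the infrared wall re-typed and carry no provers (crit-4: width 0).  R4 closes only the
conditional finite-𝕋⁴ rung `BalabanLadder.UV`; `IR` is NOT closed.  Not a slot skeleton; not to be registered.
-/

set_option autoImplicit false

noncomputable section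

open Filter Topology

namespace Summit.QuantumFields.YangMills.Cruxes.IR.PurityChannelClassical

/-! ## §1 Objects -/

/-- Green-potential budget of a zero multiset seen from `zT` in the disc `B(zT,R)`: `Σ_{ζ∈s} log(R/‖ζ − zT‖)`. -/
def greenBudget (s : Multiset ℂ) (zT : ℂ) (R : ℝ) : ℝ :=
  (s.map fun ζ => Real.log (R / ‖ζ - zT‖)).sum

/-- `∏_{ζ∈s} (z − ζ)`. -/
def zeroProd (s : Multiset ℂ) (z : ℂ) : ℂ :=
  (s.map fun ζ => z - ζ).prod

/-- The Blaschke factor of the disc `B(zT, R)` with zero at `ζ`: `b_ζ(z) = R(z − ζ)/(R² − conj(ζ − zT)(z − zT))`. -/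
def blaschke (zT : ℂ) (R : ℝ) (ζ z : ℂ) : ℂ :=
  (R : ℂ) * (z - ζ) / ((R : ℂ) ^ 2 - (starRingEnd ℂ) (ζ - zT) * (z - zT))

/-! ## §2 The two classical statements (verbatim from the lines) -/

/-- **T `TwoConstants`** (LINE harmonic-purity-channel, verbatim). -/
def TwoConstants : Prop :=
  ∀ (D : Set ℂ), IsOpen D → IsConnected D →
    ∀ (z₀ : ℂ) (δ₀ : ℝ), 0 < δ₀ → Metric.closedBall z₀ δ₀ ⊆ D → ∀ zT : ℂ, zT ∈ D →
      ∃ ω : ℝ, 0 < ω ∧ ω ≤ 1 ∧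
        ∀ F : ℂ → ℂ, DifferentiableOn ℂ F D →
          ∀ a A : ℝ, 0 < a → a ≤ A →
            (∀ z ∈ D, ‖F z‖ ≤ A) → (∀ z ∈ Metric.closedBall z₀ δ₀, ‖F z‖ ≤ a) →
              ‖F zT‖ ≤ a ^ ω * A ^ (1 - ω)

/-- **P `PoissonJensen`** (LINE jensen-purity-channel, verbatim). -/
def PoissonJensen : Prop :=
  ∀ (U D : Set ℂ) (z₀ zT : ℂ) (δ₀ R : ℝ),
    IsOpen U → IsOpen D → Bornology.IsBounded D → IsConnected D → closure D ⊆ U →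
    0 < δ₀ → Metric.closedBall z₀ δ₀ ⊆ D → IsConnected (D \ Metric.closedBall z₀ δ₀) →
    zT ∈ D → δ₀ < ‖zT - z₀‖ → D ⊆ Metric.ball zT R →
      ∃ ω : ℝ, 0 < ω ∧ ω ≤ 1 ∧
        ∀ (F g : ℂ → ℂ) (s : Multiset ℂ) (a A : ℝ),
          DifferentiableOn ℂ F U → DifferentiableOn ℂ g U → (∀ z ∈ closure D, g z ≠ 0) →
          (∀ ζ ∈ s, ζ ∈ D ∧ δ₀ < ‖ζ - z₀‖ ∧ ζ ≠ zT) →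
          0 < a → a ≤ A →
          (∀ z ∈ frontier D, ‖F z‖ ≤ A * ‖g z * zeroProd s z‖) →
          (∀ z ∈ Metric.sphere z₀ δ₀, ‖F z‖ ≤ a * ‖g z * zeroProd s z‖) →
            ‖F zT‖ ≤ a ^ ω * A ^ (1 - ω) * Real.exp (greenBudget s zT R) * ‖g zT * zeroProd s zT‖

/-! ## §3 Two sorry-free Blaschke lemmas (the heart of «P from T») -/

/-- At the target the Blaschke factor is `(zT − ζ)/R`. -/
theorem blaschke_target (zT : ℂ) {R : ℝ} (hR : R ≠ 0) (ζ : ℂ) :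
    blaschke zT R ζ zT = (zT - ζ) / (R : ℂ) := by
  unfold blaschke
  have hRc : (R : ℂ) ≠ 0 := by exact_mod_cast hR
  rw [sub_self, mul_zero, sub_zero]
  field_simp

/-- `‖b_ζ(z)‖ ≤ 1` on the closed disc `‖z − zT‖ ≤ R` when `‖ζ − zT‖ < R`:
the inequality `R‖z' − ζ'‖ ≤ |R² − conj(ζ') z'|` ⇔ `(R² − ‖z'‖²)(R² − ‖ζ'‖²) ≥ 0`. -/
theorem norm_blaschke_le_one (zT : ℂ) {R : ℝ} (hR : 0 < R) {ζ z : ℂ}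
    (hζ : ‖ζ - zT‖ < R) (hz : ‖z - zT‖ ≤ R) :
    ‖blaschke zT R ζ z‖ ≤ 1 := by
  unfold blaschke
  set ζ' : ℂ := ζ - zT with hζ'
  set z' : ℂ := z - zT with hz'
  have hzz : z - ζ = z' - ζ' := by simp [hζ', hz']
  rw [hzz]
  -- denominator is non-zero: ‖conj ζ' * z'‖ < R²
  have hden_lt : ‖(starRingEnd ℂ) ζ' * z'‖ < R ^ 2 := by
    rw [norm_mul, Complex.norm_conj]
    calc ‖ζ'‖ * ‖z'‖ ≤ ‖ζ'‖ * R := mul_le_mul_of_nonneg_left hz (norm_nonneg _)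
      _ < R * R := by exact mul_lt_mul_of_pos_right hζ hR
      _ = R ^ 2 := by ring
  have hden_ne : ((R : ℂ) ^ 2 - (starRingEnd ℂ) ζ' * z') ≠ 0 := by
    intro h
    have : ‖(starRingEnd ℂ) ζ' * z'‖ = R ^ 2 := by
      have h' : (starRingEnd ℂ) ζ' * z' = (R : ℂ) ^ 2 := by
        have := sub_eq_zero.mp h; exact this.symm
      rw [h']; simp [abs_of_pos hR]
    linarith
  rw [norm_div, div_le_one (norm_pos_iff.mpr hden_ne)]
  -- square both sides
  have h0 : 0 ≤ ‖(R : ℂ) * (z' - ζ')‖ := norm_nonneg _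
  have h1 : 0 ≤ ‖(R : ℂ) ^ 2 - (starRingEnd ℂ) ζ' * z'‖ := norm_nonneg _
  rw [← abs_of_nonneg h0, ← abs_of_nonneg h1, ← sq_le_sq, Complex.sq_norm, Complex.sq_norm]
  -- expand both normSq's in coordinates
  rw [Complex.normSq_apply, Complex.normSq_apply]
  simp only [Complex.mul_re, Complex.mul_im, Complex.sub_re, Complex.sub_im, Complex.ofReal_re, Complex.ofReal_im,
    Complex.conj_re, Complex.conj_im, zero_mul, sub_zero, add_zero]
  have hz2 : z'.re * z'.re + z'.im * z'.im ≤ R ^ 2 := by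
    have h : ‖z'‖ ^ 2 ≤ R ^ 2 := by
      have := hz; nlinarith [norm_nonneg z', this]
    rw [Complex.sq_norm, Complex.normSq_apply] at h
    linarith
  have hζ2 : ζ'.re * ζ'.re + ζ'.im * ζ'.im ≤ R ^ 2 := by
    have h : ‖ζ'‖ ^ 2 ≤ R ^ 2 := by
      have := hζ.le; nlinarith [norm_nonneg ζ', this]
    rw [Complex.sq_norm, Complex.normSq_apply] at h
    linarith
  have hRR : ((R : ℂ) ^ 2).re = R ^ 2 := by simp [sq, Complex.mul_re]
  have hRI : ((R : ℂ) ^ 2).im = 0 := by simp [sq, Complex.mul_im]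
  rw [hRR, hRI]
  nlinarith [mul_nonneg (sub_nonneg.mpr hz2) (sub_nonneg.mpr hζ2), sq_nonneg (z'.re * ζ'.im - z'.im * ζ'.re),
    sq_nonneg (z'.re - ζ'.re), sq_nonneg (z'.im - ζ'.im), hR]

/-! ## §4 Pool targets (PROVED — tree p635605; formerly sorried) -/

/-- **T** (M): two-constants / propagation of smallness along a disc chain.  Plan: compact path `γ ⊆ D` from `z₀` to `zT`
(`IsConnected D`, open ⇒ path-connected); Lebesgue number ⇒ discs `B(c_i, ρ_i) ⊆ D`, `c_{i+1} ∈ B(c_i, ρ_i/4)`, `c_0 = z₀`;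
on each disc Hadamard three-circles (`u ↦ F(c_i + e^{u})` on a vertical strip, Mathlib
`Complex.HadamardThreeLines.norm_le_interp_of_mem_verticalClosedStrip₀₁'`) propagates `sup_{B(c_i,r_i)}‖F‖ ≤ a_i` to
`sup_{B(c_i, ρ_i/2)} ‖F‖ ≤ a_i^{θ_i} A^{1−θ_i}`; `ω := ∏ θ_i`.  The exponent depends on the geometry only. -/
theorem stub_twoConstants : TwoConstants :=
  twoConstants_holds

/-- **P from T** (M−): Blaschke factors + maximum modulus, as in the module docstring.  Steps: (1) `Φ := fun z =>
F z / g z * (s.map fun ζ => (R:ℂ) / ((R:ℂ)^2 − conj(ζ − zT) * (z − zT))).prod` is `DiffContOnCl ℂ Φ D` (denominators ≠ 0 on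
`closure D ⊆ closedBall zT R` because `‖ζ − zT‖ < R`; `g ≠ 0` on `closure D`); (2) on `frontier D`:
`‖Φ z‖ = ‖F z‖/‖G z‖ · ∏‖b_ζ z‖ ≤ A` by `norm_blaschke_le_one` (note `G = g · zeroProd s` has no zero on `frontier D`:
`ζ ∈ D` open); (3) `Complex.norm_le_of_forall_mem_frontier_norm_le` (D bounded) ⇒ `‖Φ‖ ≤ A` on `D`; the same on the ball
`B(z₀,δ₀)` from the sphere bound ⇒ `‖Φ‖ ≤ a` on `closedBall z₀ δ₀`; (4) T on `D` ⇒ `‖Φ zT‖ ≤ a^ω A^{1−ω}`;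
(5) `blaschke_target`: `Φ zT = F zT / G zT · ∏ (R/… at zT) ` i.e. `‖F zT‖ = ‖Φ zT‖ · ‖G zT‖ · ∏ (R/‖zT − ζ‖)
= ‖Φ zT‖ ‖G zT‖ exp(greenBudget s zT R)` (`Real.exp_sum`, `Real.exp_log`). -/
theorem stub_poissonJensen_of_twoConstants : TwoConstants → PoissonJensen :=
  poissonJensen_of_twoConstants

/-- P over the two targets. -/
theorem poissonJensen_of_stubs : PoissonJensen :=
  stub_poissonJensen_of_twoConstants stub_twoConstants

end Summit.QuantumFields.YangMills.Cruxes.IR.PurityChannelClassical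

end
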